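import Literature.NumberTheory.EllipticCurves.Kato2004.EulerSystemValuesNegOneTwistPair
import HarnessLib

/-!
# Kato 2004, (8.1.3) / Example 13.3 with Prop. 8.12, §8.2/Lemma 8.5, Thm. 9.7 and Thm. 6.6 (1) for the PAIR of
# newforms `(f, f″)` of an elliptic curve `W/ℚ` and of its quadratic twist `W″ = W^{(−2)}` at `p = 2`, the two
# dual-exponential value data LINKED on the levels `ℚ(μ_m) ∋ √−2` (`8 ∣ m`) through the twist identification `T₂W″ ≅ T₂W`
# (one named construction fact; nothing asserted)

Topic `NumberTheory/EllipticCurves`, sub-directory `Kato2004` (namespace = path). Cell `bsd-2adic`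
(run/shared/lean/pub/bsd-2adic/), seat `bsd-2adic-addL2x` GEN 22 (crux stmt-BirchSwinnertonDyer-19098 `AdditiveRankZeroAtTwo`,
child C4″ stmt-BirchSwinnertonDyer-22618; repair-census entry R-B85 (2)). The (−2)-TWIN of
`EulerSystemValuesNegOneTwistPair.lean` (`Kato2004.exists_eulerSystem_expStar_values_negOneTwistPair_two`, GEN 21 p747170, audit
sheet hESpair PASS) — it is that file's `-- TODO(general form)` for `d = −2` and nothing else: the twist `W′ = W^{(−1)}` with
twist element `i ∈ ℚ(μ_4)` (levels `k ≥ 2`) is replaced by `W″ = W^{(−2)}` with twist element `√−2 = ζ₈ + ζ₈³ ∈ ℚ(μ_8)`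
(levels `k ≥ 3`). Companion of `EulerSystemValues.lean` (`Kato2004.exists_eulerSystem_expStar_values`, cell b2b-bsdres; audit sheet
hES PASS at `p = 2`). HONEST FRAMING: ONE `def … : Prop` construction fact (D-0014; nothing asserted, no `_holds` expected); no
theorem about BSD; nothing is booked; no class of the cell's census closes.

## Why (reading step T22 (b)/(e) of the descent sockets, odd-branch side, (−2)-split-twist block)

The descent socket `AddKatoTwo.KatoDescentSocketAtTwoAdditiveNegTwoSplitTwist` of crux 19098 (file
`Summits/…/Theorems/ByReductionTypeAtTwoAdditiveKatoDescentSocketDefs.lean`, T22 (e): «the (−2)-block … (a)–(d) word for word») reads,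
in step T22 (b), that the Λ-line of the TRANSPORTED zeta class `z̃` of `f″ = f_{W″}` (Kato's Euler system for `T₂W″` over his tower
`ℚ(μ_{2^∞}) ∋ √−2`, carried to `𝐇¹_Γ(T₂W)` along `T₂W ≅ T₂W″ ⊗ χ₋₂` and corestricted to the `ℤ₂`-layers) and the Λ-line of Kato's
class `z(f_W)` agree at every height-one prime `𝔮 ∌ 2`. Exactly as for the (−1)-block (module docstring of the companion file), the
tree PROVES this from the VALUES of the two classes under the SAME finite-level eigenfunctionals
(`Kato2004.exists_finsets_forall_layerEigenfunctional_twistLift_two_of_pairLaw`, `Kato2004.embed_twistSum_mul_eq_embed_sum_mul_negTwo`,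
`Kato2004.IwasawaH1Data.existsUnique_twistLift_of_zetaBody_two_three`, GEN 22), GIVEN one datum `Λ` for `W`, one datum `Λ″` for `W″`
and the LINK between them. The single-curve facts give `Λ`, `Λ″` SEPARATELY and no statement of the tree relates them, although in
print both ARE the dual exponential map: for `8 ∣ m` the restrictions of `T₂W` and `T₂W″` to `Gal(ℚ̄/ℚ(μ_m))` coincide (the twist
character `χ₋₂ = (−2/·)` of `ℚ(√−2)/ℚ` dies on `Gal(ℚ̄/ℚ(√−2)) ⊇ Gal(ℚ̄/ℚ(μ_m))`, `√−2 = ζ₈ + ζ₈³`), `exp*` is functorial in the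
`Gal(ℚ̄/ℚ(μ_m) ⊗ ℚ₂)`-representation, and the `ℚ`-structures `S(f_W) = ℚ·ω_W`, `S(f″) = ℚ·ω_{W″}` of `Fil⁰ D_dR` differ, under the
`ℚ(√−2)`-isomorphism `W″ ≅ W`, `(x, y) ↦ (−2x, −2√−2·y)` (Silverman X.2 Prop. 2.4 / X.5 Cor. 5.4: `ω ↦ ω/√d`, `d = −2`), by the
factor `√−2` (times a rational number, Manin constants included). This file records exactly that: ONE datum `Λ` for `W` (serving
Kato's family for `f` on all levels, VERBATIM `ZetaBody W 2 f ι κ Λ …`) and ONE datum `Λ″` for `W″` (VERBATIM `ZetaBody W″ 2 f″ ι κ″ Λ″ …`)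
with the LINK `Λ(u_* y″) = (1 ⊗ s_m)·Λ″(y″)` on every level `8 ∣ m`, where `u : T₂W″ ≃ T₂W` is the twist identification
(equivariant on `Gal(ℚ̄/ℚ(μ_m))`, `8 ∣ m`), `u_*` the coefficient change on `H¹(ℚ(μ_m), ·)` (`Kato2004.twistH1On`), and
`s_m ∈ ℚ(ζ_m)` THE square root of `−2` with `ι_m(s_m) = √2·I` under the level's complex embedding (this normalisation makes the
clause stable under the level-wise change of embeddings (F-ι-0) of `EulerSystemValues.lean`: replacing `ι_m` by `ι_m ∘ σ_a`
replaces `s_m` by `σ_a⁻¹(s_m) = χ₋₂(a)·s_m` and `Λ, Λ″, x, x″` by their `σ_a⁻¹`-transforms, and the clause is transported to itself; the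
choice between the two `ℚ(√−2)`-isomorphisms `W″ ≅ W` — they differ by `[−1]` — is the choice of the sign of `u`, matched to `s_m`
by the existential; a GLOBAL rational factor of the link is absorbed once and for all into `(κ″, Λ″, x″) ↦ (qκ″, qΛ″, qx″)`, which
preserves `ZetaBody` — so the displayed constant `1 ⊗ s_m` is a normalisation, not an extra claim).

## What is transcribed, clause by clause

* the two `ZetaBody` families: VERBATIM the companion fact `exists_eulerSystem_expStar_values` for `(W, 2, f)` and for
  `(W″, 2, f″)` [Kato (8.1.3) p. 180, §8.2/Lemma 8.5 pp. 180–184, Prop. 8.12 p. 186, Thm. 9.7 p. 189, Thm. 6.6 (1) p. 163, §13.1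
  (13.1.1)/Ex. 13.3 pp. 224–225; hypotheses as there: `W[2]` irreducible — equivalently `W″[2]` irreducible, `W″[2] ≅ W[2]`;
  `2 ∣ N`, `2 ∣ N″` allowed];
* the identification `u`: «`T_p(E^{(d)}) ≅ T_p(E) ⊗ χ_d`», equivariant on `Gal(ℚ̄/ℚ(√d))`, `d = −2` [Silverman, *AEC* X.5 Cor. 5.4
  with III §7]; here only its equivariance on the LEVELS `Gal(ℚ̄/ℚ(μ_{2^k·∏ℓ}))`, `k ≥ 3` (which fix `√−2 = ζ₈ + ζ₈³`) is displayed;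
* the LINK: «`exp*` commutes with morphisms of `p`-adic representations of `Gal(K̄/K)`» [Kato §9.4 p. 188 (the dual exponential
  map of [BK90] Def. 3.10), Bloch–Kato 1990 §3] applied to `u` over `K = ℚ(μ_m) ⊗ ℚ₂`, `8 ∣ m`, together with the comparison of
  the rational de Rham lines along `W″_{ℚ(√−2)} ≅ W_{ℚ(√−2)}` [Silverman X.2 Prop. 2.4, X.5 Cor. 5.4: `ω ↦ ω/√d`] — [folklore]
  bookkeeping, own attribution for the reading at `p = 2`.
NOT here: the definition of `exp*` or of the classes; any statement for levels `8 ∤ m` beyond the two families; any value of `Λ`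
off Kato's classes beyond the link; Thm. 12.4–12.6; any divisibility; the twists by `−1` (companion file) and `+2`; any proof. A
CONSTRUCTION fact: the identity of `u, Λ, Λ″` is displayed existentially (weaker than the transcribed statements).

## References

* K. Kato, *p-adic Hodge theory and values of zeta functions of modular forms*, Astérisque 295 (2004): §8.1 (8.1.2)–(8.1.3)
  (p. 180), §8.2 and Lemma 8.5 (pp. 180–184), Prop. 8.12 (p. 186), §9.4 (p. 188), Thm. 9.7 (p. 189), Thm. 6.6 (1) (p. 163),
  §13.1 (13.1.1) and Ex. 13.3 (pp. 224–225), Thm. 12.5 (1) (pp. 221–222). [Kato2004Asterisque]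
* S. Bloch, K. Kato, *L-functions and Tamagawa numbers of motives* (1990), §3, Def. 3.10. [BlochKato1990]
* J. H. Silverman, *The Arithmetic of Elliptic Curves*, 2nd ed. (2009), X.2 Prop. 2.4, X.5 Cor. 5.4, III §7. [SilvermanAEC2009]
* K. Rubin, *Euler Systems* (2000), Def. 2.1.1, Ch. II §4 and Ch. VI (twisting by characters of `Gal(K_∞/K)`). [Rubin2000]
* V. Pal, *Periods of quadratic twists of elliptic curves*, Proc. AMS 140 (2012) (the period ratio `Ω(E^{(d)})√|d|/Ω(E) ∈ ℚˣ`). [Pal2012]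
* Tree: `Kato2004/EulerSystemValuesNegOneTwistPair.lean` (the (−1)-twin), `Kato2004/EulerSystemValues.lean` (`ZetaBody`, `tateRep`,
  `cycSubgroup`, `cycLevel`, the companion fact), `Kato2004/H1CoefficientChange.lean` (`twistH1On`),
  `Kato2004/ZetaBodyTwistPairValuesTwoNegTwoProofs.lean` (`exists_embed_eq_sqrt_two_mul_I`: `s_m` exists when `8 ∣ m`;
  `embed_sigma_eq_chiEight'_mul`: `ι_m(σ_b s_m) = χ₈′(b)·√2·I`), `TateModuleQuadraticTwistEquivProofs.lean`
  (`WeierstrassCurve.exists_tateModule_equiv_quadraticTwist_sign`), `QuadraticTwist.lean` (`quadraticTwist`); cell memo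
  run/shared/lean/pub/bsd-2adic/addL2x/VERDICT-19098-addL2x-GEN22.md.
-/

noncomputable section

open scoped NumberField TensorProduct MatrixGroups
open Field IsDedekindDomain CongruenceSubgroup
open Literature.NumberTheory.GaloisRepresentations
open Literature.NumberTheory.EllipticCurves Literature.NumberTheory.EllipticCurves.ModularForms
open Literature.NumberTheory.EllipticCurves.Kato2004.EulerSystemValues Rat.HeightOneSpectrum

namespace Literature.NumberTheory.EllipticCurves.Kato2004

/-- **Kato 2004, (8.1.3) / Example 13.3 (`a(A)`-type, `k = 2`, `F = ℚ`) with Prop. 8.12, §8.2/Lemma 8.5, Thm. 9.7 and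
Thm. 6.6 (1), at `p = 2`, for the newform `f` of an elliptic curve `W/ℚ` with `W[2]` irreducible AND for the newform `f″` of
its quadratic twist `W″ = W^{(−2)}`, with LINKED dual-exponential data.** For every such `W` [structure facts
`ContinuousSMul / Module.Free / Module.Finite ℤ_[2] (T₂W)`, `(T₂W″)` and `W″.IsElliptic` as instance BINDERS, discharged by the
tree theorems `TateModule.continuousSMul_padicInt`, `module_free/finite_tateModule_holds`, `isElliptic_quadraticTwist`], newforms
`f ∈ S₂(Γ₀(N))` of `W` and `f″ ∈ S₂(Γ₀(N″))` of `W″`, and every family of complex embeddings `ι_m : ℚ(ζ_m) → ℂ`, there are: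
a continuous `ℤ₂`-linear identification `u : T₂W″ ≃ T₂W` equivariant on every level group `Gal(ℚ̄/ℚ(μ_{2^k·∏ℓ}))` with
`k ≥ 3` (the twist identification of Silverman X.5 Cor. 5.4 — these groups fix `√−2 = ζ₈ + ζ₈³`); real constants `κ, κ″ ≠ 0`;
and value data `Λ` on `H¹(ℚ(μ_m), T₂W)`, `Λ″` on `H¹(ℚ(μ_m), T₂W″)` (all levels `m = 2^k·∏ℓ`), such that
(LINK) on every level with `k ≥ 3` and for THE `s_m ∈ ℚ(ζ_m)` with `ι_m(s_m) = √2·I` (a square root of `−2`):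
`Λ(u_* y″) = (1 ⊗ s_m)·Λ″(y″)` for all `y″ ∈ H¹(ℚ(μ_m), T₂W″)` [§9.4 / [BK90] 3.10: `exp*` is functorial in the
`Gal(ℚ̄/ℚ(μ_m)⊗ℚ₂)`-representation; the rational de Rham lines of `W″_{ℚ(√−2)} ≅ W_{ℚ(√−2)}` differ by `√−2` up to `ℚˣ`, the
rational factor and the global sign absorbed into `(κ″, Λ″, x″)` and the sign of `u`];
(W) for all guarded data `(c, d, a, A)` of Ex. 13.3 (`A ≥ 1`, `(c, 12A) = 1`, `(d, 12N) = 1`) Kato's classes `z` and values `x`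
with `ZetaBody W 2 f ι κ Λ c d a A z x` — VERBATIM the companion fact `exists_eulerSystem_expStar_values`;
(W″) the same for `(W″, f″, κ″, Λ″)` with the guard `(d, 12N″) = 1`.
A CONSTRUCTION fact; `u, Λ, Λ″` displayed existentially; nothing for levels `8 ∤ m` beyond the two families; no proof. The
(−2)-twin of `exists_eulerSystem_expStar_values_negOneTwistPair_two` (its `-- TODO(general form)`, `d = −2`).
-- TODO(general form): the twist `W^{(2)}` (`√2 = ζ₈ + ζ₈⁻¹`, levels `8 ∣ m`, EVEN twist character `χ₈`); odd `p` with
-- `√d ∈ ℚ(μ_p)`; newforms of weight `k ≥ 2` with coefficients; `exp*` as a DEFINED map.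
[cite: Kato2004Asterisque, (8.1.3) (p. 180), §8.2 and Lemma 8.5 (pp. 180–184), Prop. 8.12 (p. 186), §9.4 (p. 188), Thm. 9.7 (p. 189), Thm. 6.6 (1) (p. 163), §13.1 (13.1.1) and Ex. 13.3 (pp. 224–225)]
[cite: BlochKato1990, §3 Def. 3.10–3.11 (the exponential and dual exponential maps, functorial in V)]
[cite: SilvermanAEC2009, X.2 Prop. 2.4, X.5 Cor. 5.4 and III §7 (the ℚ(√d)-isomorphism E^{(d)} ≅ E and T_p as a functor)]
[cite: Rubin2000, Def. 2.1.1, Ch. II §4 and Ch. VI (twisting Euler systems by characters)] -/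
def exists_eulerSystem_expStar_values_negTwoTwistPair_two : Prop :=
  ∀ (W : WeierstrassCurve ℚ) [W.IsElliptic]
    [ContinuousSMul ℤ_[2] (W.tateModule 2)] [Module.Free ℤ_[2] (W.tateModule 2)]
    [Module.Finite ℤ_[2] (W.tateModule 2)]
    [(W.quadraticTwist (-2)).IsElliptic]
    [ContinuousSMul ℤ_[2] ((W.quadraticTwist (-2)).tateModule 2)]
    [Module.Free ℤ_[2] ((W.quadraticTwist (-2)).tateModule 2)]
    [Module.Finite ℤ_[2] ((W.quadraticTwist (-2)).tateModule 2)],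
    W.HasIrreducibleModPGaloisRep 2 →
    ∀ {N : ℕ} [NeZero N] (f : CuspForm (Gamma0 N) 2), IsNewformOf W f →
    ∀ {N' : ℕ} [NeZero N'] (f' : CuspForm (Gamma0 N') 2), IsNewformOf (W.quadraticTwist (-2)) f' →
    ∀ (ι : (m : ℕ) → (CyclotomicField m ℚ →+* ℂ)),
    ∃ (u : (W.quadraticTwist (-2)).tateModule 2 ≃ₗ[ℤ_[2]] W.tateModule 2) (hu : Continuous u)
      (hV : ∀ k : ℕ, 3 ≤ k → ∀ (r : Finset (HeightOneSpectrum (𝓞 ℚ))) (σ : absoluteGaloisGroup ℚ),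
        σ ∈ cycSubgroup 2 k r → ∀ x : (W.quadraticTwist (-2)).tateModule 2, u (σ • x) = σ • u x),
    ∃ κ : ℝ, κ ≠ 0 ∧ ∃ κ' : ℝ, κ' ≠ 0 ∧
    ∃ (Λ : ∀ (k : ℕ) (r : Finset (HeightOneSpectrum (𝓞 ℚ))),
        H1 (tateRep W 2) (cycSubgroup 2 k r) →ₗ[ℤ_[2]] ℚ_[2] ⊗[ℚ] CyclotomicField (cycLevel 2 k r) ℚ)
      (Λ' : ∀ (k : ℕ) (r : Finset (HeightOneSpectrum (𝓞 ℚ))),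
        H1 (tateRep (W.quadraticTwist (-2)) 2) (cycSubgroup 2 k r) →ₗ[ℤ_[2]]
          ℚ_[2] ⊗[ℚ] CyclotomicField (cycLevel 2 k r) ℚ),
      -- (LINK) `Λ(u_* y″) = (1 ⊗ s_m)·Λ″(y″)` on the levels `k ≥ 3`, `ι_m(s_m) = √2·I = √−2`
      (∀ (k : ℕ) (hk : 3 ≤ k) (r : Finset (HeightOneSpectrum (𝓞 ℚ))) (s : CyclotomicField (cycLevel 2 k r) ℚ),
        ι (cycLevel 2 k r) s = ((Real.sqrt 2 : ℝ) : ℂ) * Complex.I →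
        ∀ y' : H1 (tateRep (W.quadraticTwist (-2)) 2) (cycSubgroup 2 k r),
          Λ k r (twistH1On W (W.quadraticTwist (-2)) u hu (hV k hk r) y') =
            ((1 : ℚ_[2]) ⊗ₜ[ℚ] s) * Λ' k r y') ∧
      -- (W) Kato's family for `f` with the datum `Λ` — VERBATIM `exists_eulerSystem_expStar_values` for `(W, 2, f, ι)`
      (∀ (c d a : ℤ) (A : ℕ), 0 < A → Int.gcd c (6 * 2 * A) = 1 → Int.gcd d (6 * 2 * N) = 1 →
        ∃ (z : ∀ (k : ℕ) (r : (cyclotomicLevelsRat 2 (badPlaces c d A N)).Ideals),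
              H1 (tateRep W 2) ((cyclotomicLevelsRat 2 (badPlaces c d A N)).level k r.1))
          (x : ∀ (k : ℕ) (r : (cyclotomicLevelsRat 2 (badPlaces c d A N)).Ideals),
              CyclotomicField (cycLevel 2 k r.1) ℚ),
          ZetaBody W 2 f ι κ Λ c d a A z x) ∧
      -- (W″) Kato's family for `f″` with the datum `Λ″` — VERBATIM the companion fact for `(W″, 2, f″, ι)`
      (∀ (c d a : ℤ) (A : ℕ), 0 < A → Int.gcd c (6 * 2 * A) = 1 → Int.gcd d (6 * 2 * N') = 1 →
        ∃ (z' : ∀ (k : ℕ) (r : (cyclotomicLevelsRat 2 (badPlaces c d A N')).Ideals),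
              H1 (tateRep (W.quadraticTwist (-2)) 2) ((cyclotomicLevelsRat 2 (badPlaces c d A N')).level k r.1))
          (x' : ∀ (k : ℕ) (r : (cyclotomicLevelsRat 2 (badPlaces c d A N')).Ideals),
              CyclotomicField (cycLevel 2 k r.1) ℚ),
          ZetaBody (W.quadraticTwist (-2)) 2 f' ι κ' Λ' c d a A z' x')

end Literature.NumberTheory.EllipticCurves.Kato2004

end
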